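import Mathlib
import Literature.Computability.AlgebraicComplexity.EquivariantDC
import Literature.Computability.AlgebraicComplexity.LRPencilOfMatrix
import Literature.Computability.AlgebraicComplexity.LandsbergRessayreNormalForm
import Summits.ValiantsHypothesis.ValiantsHypothesis.Theorems.FreeSubtorusConfusionCoveringGenericElement
import Summits.ValiantsHypothesis.ValiantsHypothesis.Theorems.FreeSubtorusConfusionCoveringGradedForm
import HarnessLib

/-!
# Route FreeSubtorus — crux `OrbitDimensionBound` (stmt-ValiantsHypothesis-16133), line `channel_covering`
# (a RUNG line: target `Channel.OneChannelShadow`; the crux stays OPEN), registered stub 1 `stub_channelGradedForm`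

`stub_channelGradedForm` below is the registered statement `Stmt.stub_channelGradedForm` of
`Cruxes/OrbitDimensionBound/Lines/channel_covering.lean` with the line-local vocabulary (`IsChannelDetRepr` from
`Lines/ChannelLadder.lean`, `subtorus`/`torusGen` from `Lines/TorsionLadder.lean`, `IsGeneric`, `IsGradedChannelForm`)
UNFOLDED verbatim (Cruxes files are not importable from `Theorems/`); the skeleton closes its `sorry` by
`exact …Theorems.FreeSubtorusOrbitDimensionBound.stub_channelGradedForm` (scratch-checked rc 0 against verbatim copies of
the five definitions).  With it the line `channel_covering` rests on `stub_channelChains` and `stub_servedCount`.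
Merged desk, CLAIM-FIRST #7 of val-lit-p7 g10 (2026-08-28), `--supports stmt-ValiantsHypothesis-16133 --as helper`.

Honest framing: a registered stub (size S/M, bookkeeping) of a RUNG line inside one route; the rung `OneChannelShadow`,
the crux `OrbitDimensionBound` (stmt-16133) and route FreeSubtorus stay OPEN; census-neutral; nothing here bears on
`VP ≠ VNP` (NOT proved).  No definitions, no named facts.
-/

set_option linter.dupNamespace false
set_option autoImplicit false

noncomputable section

open Matrix MvPolynomial Finset
open Literature.Computability.AlgebraicComplexity LRPencil
open Summit.ValiantsHypothesis.ValiantsHypothesis.Theorems.FreeSubtorusConfusionCovering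
  (stub_genericElement exists_gradedForm)

namespace Summit.ValiantsHypothesis.ValiantsHypothesis.Theorems.FreeSubtorusOrbitDimensionBound

namespace ChannelGradedForm

/-- A product through an index type with at most one element factors: `Σ_t a t * b t = (Σ a)(Σ b)` for `s ≤ 1`.
[folklore] -/
theorem sum_mul_eq_sum_mul_sum_of_le_one {s : ℕ} (hs : s ≤ 1) (a b : Fin s → ℂ) :
    ∑ t, a t * b t = (∑ t, a t) * ∑ t, b t := by
  rcases Nat.le_one_iff_eq_zero_or_eq_one.1 hs with rfl | rfl
  · simp
  · simp

/-- Removing constants keeps entries affine. [folklore] -/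
theorem totalDegree_sub_C_le_one {σ : Type*} {p : MvPolynomial σ ℂ} (hp : p.totalDegree ≤ 1) (c : ℂ) :
    (p - C c).totalDegree ≤ 1 :=
  (totalDegree_sub _ _).trans (max_le hp (by simp))

end ChannelGradedForm

open ChannelGradedForm

/-- **Registered stub 1 of the line `channel_covering` — `Stmt.stub_channelGradedForm`** (the line-local
`IsChannelDetRepr` (ChannelLadder), `subtorus`/`torusGen` (TorsionLadder), `IsGeneric`, `IsGradedChannelForm` UNFOLDED
verbatim; `constPart`, `coeffMat`, `Matrix.linSubstEntries`, `perPoly`, `IsAffineDetRepr` are the Literature notions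
the line itself uses; the skeleton `Cruxes/OrbitDimensionBound/Lines/channel_covering.lean` closes its `sorry` by
`exact` — scratch-checked against verbatim copies).  GRADED ONE-CHANNEL FORM: a generic element `(d, e)` of `T_Λ`
(the landed `stub_genericElement`) as a diagonal `γ ∈ T_Λ`; ONE lift `(g, h)` of `γ` for the channel-corrected matrix
`A = B − U V` (`IsChannelDetRepr 1`); `g A₀ = A₀ h` (`mul_constPart_eq_of_linSubstEntries_eq`) and
`g A_{kl} = d_k e_l · A_{kl} h` (`coeffMat_linSubstEntries`, `coeffMat_C_mul_mul_C`); eigenspace-adapted bases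
(the tree's `exists_gradedForm` with weights `w (k,l) = d_k e_l`); and `P (U V) Q = (P u)(v Q)ᵀ` has rank `≤ 1`
because `U V` has inner dimension `s ≤ 1`.  Merged desk CLAIM-FIRST #7 of val-lit-p7 g10 (2026-08-28),
`--supports stmt-ValiantsHypothesis-16133 --as helper`.

Honest framing: a registered stub (size S/M, bookkeeping) of a RUNG line inside one route; the line's stubs
`stub_channelChains` / `stub_servedCount`, the rung `OneChannelShadow`, the crux `OrbitDimensionBound` (stmt-16133) and
route FreeSubtorus stay OPEN; census-neutral; nothing here bears on `VP ≠ VNP` (NOT proved).  No definitions, no named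
facts. [cite: LandsbergRessayre2017, §6] -/
theorem stub_channelGradedForm :
    ∀ (n m r : ℕ) (Λ : Fin r → (Fin n ⊕ Fin n) → ℤ) (B : Matrix (Fin m) (Fin m) (MvPolynomial (Fin n × Fin n) ℂ)),
      3 ≤ n → (∀ i, (∑ k, Λ i (Sum.inl k)) = 0 ∧ (∑ l, Λ i (Sum.inr l)) = 0) →
      (IsAffineDetRepr (perPoly (Fin n) ℂ) B ∧
        ∃ (s : ℕ) (U : Matrix (Fin m) (Fin s) ℂ) (V : Matrix (Fin s) (Fin m) ℂ), s ≤ 1 ∧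
          ∀ γ ∈ Subgroup.closure {γ : Matrix.GeneralLinearGroup (Fin n × Fin n) ℂ |
              ∃ d e : Fin n → ℂˣ, (∀ i, (∏ k, (d k) ^ (Λ i (Sum.inl k))) * (∏ l, (e l) ^ (Λ i (Sum.inr l))) = 1) ∧
                (γ : Matrix (Fin n × Fin n) (Fin n × Fin n) ℂ) =
                  Matrix.diagonal (fun p => (d p.1 : ℂ) * (e p.2 : ℂ))},
            ∃ g h : GL (Fin m) ℂ,
              Literature.Computability.AlgebraicComplexity.Matrix.linSubstEntries γ (B - (U * V).map C) =
                (g : Matrix (Fin m) (Fin m) ℂ).map C * (B - (U * V).map C) *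
                  ((h⁻¹ : GL (Fin m) ℂ) : Matrix (Fin m) (Fin m) ℂ).map C) →
      ∃ (d e : Fin n → ℂˣ) (α β : Fin m → ℂ),
        ((∀ i, (∏ k, (d k) ^ (Λ i (Sum.inl k))) * (∏ l, (e l) ^ (Λ i (Sum.inr l))) = 1) ∧
          (∀ u : Fin n × Fin n → ℕ, u ≠ 0 → (∏ p, ((d p.1 : ℂ) * (e p.2 : ℂ)) ^ (u p)) ≠ 1) ∧
          (∀ χ : (Fin n ⊕ Fin n) → ℤ,
            (∏ k, (d k) ^ (χ (Sum.inl k))) * (∏ l, (e l) ^ (χ (Sum.inr l))) = 1 →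
            ∃ (N : ℤ) (a : Fin r → ℤ), N ≠ 0 ∧ N • χ = ∑ i, a i • Λ i)) ∧
        ∃ (P Q : GL (Fin m) ℂ) (u v : Fin m → ℂ),
          (∀ i j, constPart ((P : Matrix (Fin m) (Fin m) ℂ).map C * B * (Q : Matrix (Fin m) (Fin m) ℂ).map C -
              (Matrix.vecMulVec u v).map C) i j ≠ 0 → β i = α j) ∧
          (∀ (p : Fin n × Fin n) i j,
            coeffMat ((P : Matrix (Fin m) (Fin m) ℂ).map C * B * (Q : Matrix (Fin m) (Fin m) ℂ).map C -
              (Matrix.vecMulVec u v).map C) p i j ≠ 0 → β i = (d p.1 : ℂ) * (e p.2 : ℂ) * α j) := by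
  intro n m r Λ B hn hΛ hCh
  classical
  obtain ⟨hB, s, U, V, hs, hlift⟩ := hCh
  -- (1) a generic element of `T_Λ`
  obtain ⟨d, e, hrel, hnorel, hsep⟩ := stub_genericElement n r Λ (fun i => (hΛ i).1)
  -- as an element of `GL_{n²}` in the generating set
  let γ : GL (Fin n × Fin n) ℂ :=
    ⟨Matrix.diagonal fun p => (d p.1 : ℂ) * (e p.2 : ℂ),
      Matrix.diagonal fun p => (((d p.1 * e p.2)⁻¹ : ℂˣ) : ℂ), by
        rw [Matrix.diagonal_mul_diagonal, ← Matrix.diagonal_one]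
        congr 1; funext p
        rw [← Units.val_mul, ← Units.val_mul, mul_inv_cancel, Units.val_one], by
        rw [Matrix.diagonal_mul_diagonal, ← Matrix.diagonal_one]
        congr 1; funext p
        rw [← Units.val_mul, ← Units.val_mul, inv_mul_cancel, Units.val_one]⟩
  have hγ : (γ : Matrix (Fin n × Fin n) (Fin n × Fin n) ℂ) = Matrix.diagonal fun p => (d p.1 : ℂ) * (e p.2 : ℂ) :=
    rfl
  have hγmem : γ ∈ Subgroup.closure {γ : Matrix.GeneralLinearGroup (Fin n × Fin n) ℂ |
      ∃ d e : Fin n → ℂˣ, (∀ i, (∏ k, (d k) ^ (Λ i (Sum.inl k))) * (∏ l, (e l) ^ (Λ i (Sum.inr l))) = 1) ∧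
        (γ : Matrix (Fin n × Fin n) (Fin n × Fin n) ℂ) =
          Matrix.diagonal (fun p => (d p.1 : ℂ) * (e p.2 : ℂ))} :=
    Subgroup.subset_closure ⟨d, e, hrel, hγ⟩
  -- (2) one lift of `γ` for the channel-corrected matrix `A = B - U V`
  set A : Matrix (Fin m) (Fin m) (MvPolynomial (Fin n × Fin n) ℂ) := B - (U * V).map C with hA
  have hAaff : ∀ i j, (A i j).totalDegree ≤ 1 := fun i j => by
    simp only [hA, Matrix.sub_apply, Matrix.map_apply]
    exact totalDegree_sub_C_le_one (hB.1 i j) _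
  obtain ⟨g, h, hgh⟩ := hlift γ hγmem
  have hX0 : (g : Matrix (Fin m) (Fin m) ℂ) * constPart A = constPart A * (h : Matrix (Fin m) (Fin m) ℂ) :=
    mul_constPart_eq_of_linSubstEntries_eq hgh
  have hhinv : ((h⁻¹ : GL (Fin m) ℂ) : Matrix (Fin m) (Fin m) ℂ) * (h : Matrix (Fin m) (Fin m) ℂ) = 1 := by
    rw [← Units.val_mul, inv_mul_cancel, Units.val_one]
  have hXv : ∀ v : Fin n × Fin n, (g : Matrix (Fin m) (Fin m) ℂ) * coeffMat A v =
      ((d v.1 : ℂ) * (e v.2 : ℂ)) • (coeffMat A v * (h : Matrix (Fin m) (Fin m) ℂ)) := by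
    intro v
    have h1 := congrArg (fun M => coeffMat M v) hgh
    rw [coeffMat_linSubstEntries γ A hAaff v, coeffMat_C_mul_mul_C, hγ,
      Finset.sum_eq_single v
        (fun i _ hi => by rw [Matrix.diagonal_apply_ne _ (Ne.symm hi), zero_smul])
        (fun hv => absurd (Finset.mem_univ v) hv), Matrix.diagonal_apply_eq] at h1
    -- `h1 : (d e) • A_v = g A_v h⁻¹`
    calc (g : Matrix (Fin m) (Fin m) ℂ) * coeffMat A v
        = (g : Matrix (Fin m) (Fin m) ℂ) * coeffMat A v *
            (((h⁻¹ : GL (Fin m) ℂ) : Matrix (Fin m) (Fin m) ℂ) * (h : Matrix (Fin m) (Fin m) ℂ)) := by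
          rw [hhinv, Matrix.mul_one]
      _ = (((d v.1 : ℂ) * (e v.2 : ℂ)) • coeffMat A v) * (h : Matrix (Fin m) (Fin m) ℂ) := by
          rw [← Matrix.mul_assoc, ← h1]
      _ = ((d v.1 : ℂ) * (e v.2 : ℂ)) • (coeffMat A v * (h : Matrix (Fin m) (Fin m) ℂ)) := by
          rw [Matrix.smul_mul]
  -- (3) eigenspace-adapted bases
  obtain ⟨P, Q, α, β, hconst, hcoef, -, -⟩ :=
    exists_gradedForm A (fun v : Fin n × Fin n => (d v.1 : ℂ) * (e v.2 : ℂ)) (g : Matrix (Fin m) (Fin m) ℂ)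
      (h : Matrix (Fin m) (Fin m) ℂ) hX0 hXv
  -- (4) the conjugated channel `P (U V) Q = (P u) (v Q)ᵀ`
  set u : Fin m → ℂ := fun i => ∑ t, ((P : Matrix (Fin m) (Fin m) ℂ) * U) i t with hu
  set v : Fin m → ℂ := fun j => ∑ t, (V * (Q : Matrix (Fin m) (Fin m) ℂ)) t j with hv
  have hPUVQ : (P : Matrix (Fin m) (Fin m) ℂ) * (U * V) * (Q : Matrix (Fin m) (Fin m) ℂ) = Matrix.vecMulVec u v := by
    rw [show (P : Matrix (Fin m) (Fin m) ℂ) * (U * V) * (Q : Matrix (Fin m) (Fin m) ℂ) =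
        ((P : Matrix (Fin m) (Fin m) ℂ) * U) * (V * (Q : Matrix (Fin m) (Fin m) ℂ)) by
      simp only [Matrix.mul_assoc]]
    ext i j
    rw [Matrix.mul_apply, Matrix.vecMulVec_apply, hu, hv]
    exact sum_mul_eq_sum_mul_sum_of_le_one hs _ _
  have hconj : (P : Matrix (Fin m) (Fin m) ℂ).map C * B * (Q : Matrix (Fin m) (Fin m) ℂ).map C -
      (Matrix.vecMulVec u v).map C =
      (P : Matrix (Fin m) (Fin m) ℂ).map C * A * (Q : Matrix (Fin m) (Fin m) ℂ).map C := by
    rw [hA, Matrix.mul_sub, Matrix.sub_mul, ← hPUVQ, Matrix.map_mul, Matrix.map_mul, Matrix.mul_assoc,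
      Matrix.mul_assoc]
  refine ⟨d, e, α, β, ⟨hrel, hnorel, hsep⟩, P, Q, u, v, fun i j hij => ?_, fun p i j hij => ?_⟩
  · rw [hconj] at hij
    exact hconst i j hij
  · rw [hconj] at hij
    exact hcoef p i j hij

end Summit.ValiantsHypothesis.ValiantsHypothesis.Theorems.FreeSubtorusOrbitDimensionBound

end
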